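import Summits.ValiantsHypothesis.ValiantsHypothesis.Theorems.MonotoneRestorationOrbitRestorationQPLevelStructureA
import Summits.ValiantsHypothesis.ValiantsHypothesis.Theorems.MonotoneRestorationOrbitRestorationQPRestorable
import Summits.ValiantsHypothesis.ValiantsHypothesis.Theorems.MonotoneRestorationOrbitRestorationQPWaringJennrich
import HarnessLib

/-!
# A_∞ on the few-forms stratum: matrix-symmetric polynomials in fewer than `n/4` affine forms are `Q(U)`

Route MonotoneRestoration, crux `OrbitRestorationQP` (stmt-ValiantsHypothesis-18293), line `depth-three-rung`,
stub A_∞ `stub_sigmaPiSigmaValue`.  Namespace `Summit.ValiantsHypothesis.ValiantsHypothesis.Theorems.FewForms`.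

A third sub-rung of A_∞, NOT based on identifiability (so it also covers families with non-unique minimal
depth-3 representations): if a matrix-symmetric `f` is a polynomial expression in at most `r` affine forms with
`4r + 12 ≤ n` — in particular a ΣΛΣ expression `Σ_{i<r} a_i (ℓ_i + b_i)^{d_i}` with FEW powers, any degrees,
any forms — then the ESSENTIAL SPACE `ess f` (landed `…LinearSubalgebra.lean`, least space of affine forms
generating `f`) has dimension `≤ r + 1`, is stable under the whole matrix action (equivariance `ess_map` +
invariance of `f`), hence lies in `span(1, U)` by the landed `LevelStructure.mem_span_one_U`
(`…LevelStructureA.lean`, from `StableForms`), so `f = Q(U)` with `U = Σ_{p,q} x_pq`, which is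
orbit-restorable with constant `5` (`Restorable.qpOrbitRestorable_aeval_U`).

* `exists_aeval_U_of_mem_adjoin` — **a matrix-symmetric polynomial lying in the subalgebra generated by `r`
  affine forms, `4r + 12 ≤ n`, is a univariate polynomial in `U`**;
* `qpOrbitRestorable_of_mem_adjoin` — hence `QPOrbitRestorable 5 n f`;
* `restoration_of_fewForms` — family form: eventually-few-forms matrix-symmetric families are
  quasi-polynomially orbit-restorable (small levels by `Restorable.qpOrbitRestorable_of_invariant`);
* `sigmaLambdaSigma_fewPowers_restoration` — the ΣΛΣ corollary (sums of `< n/4 - 3` scaled powers of affine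
  forms, mixed degrees allowed).

Honest label: sub-rung of A_∞ (few forms); A_∞ itself — polynomially many forms — stays open; VP ≠ VNP
untouched. [folklore]
-/

noncomputable section

open scoped Classical

-- `Summit.ValiantsHypothesis.ValiantsHypothesis.…` is the tree's single-conjunct layout (Sub = Summit).
set_option linter.dupNamespace false

namespace Summit.ValiantsHypothesis.ValiantsHypothesis.Theorems

namespace FewForms

open MvPolynomial Finset Equiv OrbitRestorationQPDepthThreeRung LinearSubalgebra LevelStructure

variable {n : ℕ}

/-- **A matrix-symmetric polynomial in few affine forms is a polynomial in `U`.**  If `f` lies in the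
subalgebra generated by `r` polynomials of total degree `≤ 1`, `4r + 12 ≤ n`, and `f` is invariant under
independent row and column permutations, then `f = Q(U)` for a univariate `Q`. [folklore] -/
theorem exists_aeval_U_of_mem_adjoin {r : ℕ} (hn : 4 * r + 12 ≤ n)
    (ℓ : Fin r → MvPolynomial (Fin n × Fin n) ℂ) (hℓ : ∀ i, (ℓ i).totalDegree ≤ 1)
    {f : MvPolynomial (Fin n × Fin n) ℂ} (hf : f ∈ Algebra.adjoin ℂ (Set.range ℓ))
    (hsym : ∀ σ τ : Perm (Fin n), mact σ τ f = f) :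
    ∃ Q : Polynomial ℂ, f = Polynomial.aeval (U n) Q := by
  -- an admissible space of dimension `≤ r + 1`
  set S : Finset (MvPolynomial (Fin n × Fin n) ℂ) := insert (C 1) (Finset.univ.image ℓ) with hS
  set Λ : Submodule ℂ (MvPolynomial (Fin n × Fin n) ℂ) := Submodule.span ℂ (S : Set _) with hΛ
  have hadm : Admissible f Λ := by
    refine ⟨?_, Submodule.subset_span (by simp [hS]), ?_⟩
    · rw [hΛ, Submodule.span_le]
      intro q hq
      simp only [hS, Finset.coe_insert, Finset.coe_image, Finset.coe_univ, Set.image_univ, Set.mem_insert_iff,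
        Set.mem_range] at hq
      rcases hq with rfl | ⟨i, rfl⟩
      · exact mem_deg1.2 (by rw [totalDegree_C]; exact Nat.zero_le _)
      · exact mem_deg1.2 (hℓ i)
    · refine Algebra.adjoin_mono ?_ hf
      rintro _ ⟨i, rfl⟩
      exact Submodule.subset_span (by simp [hS])
  haveI : FiniteDimensional ℂ Λ := FiniteDimensional.span_of_finite ℂ (Finset.finite_toSet S)
  have hfinΛ : Module.finrank ℂ Λ ≤ r + 1 := by
    refine (finrank_span_finset_le_card S).trans ?_
    rw [hS]
    refine (Finset.card_insert_le _ _).trans ?_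
    have h1 : (Finset.univ.image ℓ).card ≤ (Finset.univ : Finset (Fin r)).card := Finset.card_image_le
    rw [Finset.card_univ, Fintype.card_fin] at h1
    omega
  -- the essential space: small, affine, stable under the whole matrix action
  haveI : FiniteDimensional ℂ (ess f) := Submodule.finiteDimensional_of_le (ess_le hadm)
  have hdim : 4 * Module.finrank ℂ (ess f) + 8 ≤ n := by
    have := finrank_ess_le hadm
    omega
  have hstab : ∀ σ τ : Perm (Fin n), (ess f).map (mact σ τ).toLinearEquiv.toLinearMap ≤ ess f := by
    intro σ τ
    have h := ess_map (mact σ τ) (fun q hq => by rw [totalDegree_mact]; exact hq)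
      (fun q hq => by
        have := totalDegree_mact σ τ ((mact σ τ).symm q)
        rw [AlgEquiv.apply_symm_apply] at this
        rw [← this]; exact hq) f
    rw [hsym σ τ] at h
    exact h.symm.le
  have hess : ∀ w ∈ ess f, w ∈ Submodule.span ℂ ({C 1, U n} : Set (MvPolynomial (Fin n × Fin n) ℂ)) :=
    fun w hw => mem_span_one_U (admissible_ess f).1 hstab hdim hw
  have h2 : Algebra.adjoin ℂ (ess f : Set (MvPolynomial (Fin n × Fin n) ℂ)) ≤ Algebra.adjoin ℂ {U n} := by
    refine Algebra.adjoin_le fun w hw => ?_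
    obtain ⟨x, y, hxy⟩ := Submodule.mem_span_pair.1 (hess w hw)
    rw [← hxy, smul_eq_C_mul, smul_eq_C_mul, C_1, mul_one]
    exact Subalgebra.add_mem _ (Subalgebra.algebraMap_mem _ x)
      (Subalgebra.mul_mem _ (Subalgebra.algebraMap_mem _ y) (Algebra.subset_adjoin (Set.mem_singleton _)))
  have hmem : f ∈ (Polynomial.aeval (U n) : Polynomial ℂ →ₐ[ℂ] _).range := by
    rw [← Algebra.adjoin_singleton_eq_range_aeval]
    exact h2 (mem_adjoin_ess f)
  obtain ⟨Q, hQ⟩ := hmem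
  exact ⟨Q, hQ.symm⟩

/-- **Few forms ⇒ orbit-restorable with constant `5`.** [folklore] -/
theorem qpOrbitRestorable_of_mem_adjoin {r : ℕ} (hn : 4 * r + 12 ≤ n)
    (ℓ : Fin r → MvPolynomial (Fin n × Fin n) ℂ) (hℓ : ∀ i, (ℓ i).totalDegree ≤ 1)
    {f : MvPolynomial (Fin n × Fin n) ℂ} (hf : f ∈ Algebra.adjoin ℂ (Set.range ℓ))
    (hsym : ∀ σ τ : Perm (Fin n), mact σ τ f = f) : QPOrbitRestorable 5 n f := by
  obtain ⟨Q, hQ⟩ := exists_aeval_U_of_mem_adjoin hn ℓ hℓ hf hsym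
  rw [hQ]
  exact Restorable.qpOrbitRestorable_aeval_U Q

/-- **THE FEW-FORMS STRATUM OF A_∞ (family form).**  A matrix-symmetric family which, from some level on, is a
polynomial expression in at most `r_n` affine forms with `4 r_n + 12 ≤ n`, is quasi-polynomially
orbit-restorable. [folklore] -/
theorem restoration_of_fewForms (f : (n : ℕ) → MvPolynomial (Fin n × Fin n) ℂ) (hsym : IsMatrixSymmetric f)
    (h : ∃ n₀ : ℕ, ∀ n : ℕ, n₀ ≤ n → ∃ (r : ℕ) (ℓ : Fin r → MvPolynomial (Fin n × Fin n) ℂ),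
      4 * r + 12 ≤ n ∧ (∀ i, (ℓ i).totalDegree ≤ 1) ∧ f n ∈ Algebra.adjoin ℂ (Set.range ℓ)) :
    ∃ c : ℕ, ∀ n : ℕ, QPOrbitRestorable c n (f n) := by
  obtain ⟨n₀, hn₀⟩ := h
  refine ⟨n₀.factorial + 5, fun n => ?_⟩
  by_cases hn : n₀ ≤ n
  · obtain ⟨r, ℓ, hr, hℓ, hf⟩ := hn₀ n hn
    refine Restorable.qpOrbitRestorable_mono (by omega) (qpOrbitRestorable_of_mem_adjoin hr ℓ hℓ hf fun σ τ => ?_)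
    rw [mact_apply]; exact hsym n σ τ
  · refine Restorable.qpOrbitRestorable_mono ?_
      (Restorable.qpOrbitRestorable_of_invariant (f n) fun σ => ValueOrbit.ren_eq_of_matrixSymmetric (hsym n) σ)
    have : n.factorial ≤ n₀.factorial := Nat.factorial_le (by omega)
    omega

/-- **The ΣΛΣ corollary: few powers.**  A matrix-symmetric family which, from some level on, is a sum of
`r_n` scaled powers (mixed degrees allowed) of affine forms with `4 r_n + 12 ≤ n` is quasi-polynomially
orbit-restorable — no identifiability, independence or degree condition. [folklore] -/
theorem sigmaLambdaSigma_fewPowers_restoration (f : (n : ℕ) → MvPolynomial (Fin n × Fin n) ℂ)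
    (hsym : IsMatrixSymmetric f)
    (h : ∃ n₀ : ℕ, ∀ n : ℕ, n₀ ≤ n → ∃ (r : ℕ) (d : Fin r → ℕ) (w : Fin r → (Fin n × Fin n) → ℂ)
      (b a : Fin r → ℂ), 4 * r + 12 ≤ n ∧
        f n = ∑ i, C (a i) * (WaringJennrich.lin (w i) + C (b i)) ^ (d i)) :
    ∃ c : ℕ, ∀ n : ℕ, QPOrbitRestorable c n (f n) := by
  refine restoration_of_fewForms f hsym ?_
  obtain ⟨n₀, hn₀⟩ := h
  refine ⟨n₀, fun n hn => ?_⟩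
  obtain ⟨r, d, w, b, a, hr, hf⟩ := hn₀ n hn
  refine ⟨r, fun i => WaringJennrich.lin (w i) + C (b i), hr, fun i => ?_, ?_⟩
  · refine (totalDegree_add _ _).trans (max_le ?_ (by rw [totalDegree_C]; exact Nat.zero_le _))
    unfold WaringJennrich.lin
    refine (totalDegree_finsetSum _ _).trans (Finset.sup_le fun x _ => ?_)
    exact (totalDegree_mul _ _).trans (by rw [totalDegree_C, totalDegree_X, zero_add])
  · rw [hf]
    refine Subalgebra.sum_mem _ fun i _ => Subalgebra.mul_mem _ (Subalgebra.algebraMap_mem _ (a i))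
      (Subalgebra.pow_mem _ (Algebra.subset_adjoin (Set.mem_range_self i)) _)

end FewForms

end Summit.ValiantsHypothesis.ValiantsHypothesis.Theorems

end
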